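import Mathlib.Data.ZMod.Basic
import Mathlib.Combinatorics.SimpleGraph.Basic
import Mathlib.Order.LiminfLimsup
import Literature.Probability.LatticeModels.LatticeGraph
import Literature.Probability.LatticeModels.ThermodynamicLimit
import Literature.Probability.LatticeModels.CorrelationDecay
import HarnessLib

-- provenance: harness21/H21/H21/Prelude/QLatticeAQFT/LatticeTori.lean @ e53059b (interim HEAD d8f2665); M5 mechanical rewrite
/-!
# Discrete tori: rectangular tori, the torus metric, and the long-range-order convention

Trunk: QLatticeAQFT (prelude item Q5a `LatticeTori`, notions `local_hamiltonian_dynamics`,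
`long_range_order`). This file is pure bookkeeping shared by all Part-Q families that work on
discrete tori of growing side (Hubbard S01, S11–S13; pair-field LRO Q8; spin liquids Q14; LTQO Q11).

Contents:

* Rectangular tori `RectTorusSite Ls = Π i, ZMod (Ls i)` for a side vector `Ls : Fin d → ℕ`, their
  nearest-neighbour graph `rectTorusGraph Ls` (via `SimpleGraph.fromRel`) and the projection
  `RectTorus.proj Ls : Site d → RectTorusSite Ls`. The cubic torus `StatMech.TorusSite d L` is the
  special case `Ls = fun _ => L` *definitionally* (`rectTorusSite_const`, `rectTorusGraph_const`),
  so every notion below specialises to cubic tori for free.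
* The torus (`ℓ^∞`, periodic) metric: `torusNorm`, `torusDist`, `torusBall`, `mem_torusBall_iff`.
* The LRO convention of the outline (§0): a family of torus two-point functions
  `G L : TorusSite d L → TorusSite d L → ℝ` is pulled back to `Site d = ℤ^d` along `Torus.proj L`
  (`torusPullback`) and fed to `StatMech.HasLongRangeOrder` over the fundamental domain
  `halfOpenBox d L` (side `L`, `L^d` sites): `HasTorusLRO`, `HasStaggeredTorusLRO` (Néel sign
  `latticeStagger`). The unfolding lemmas `hasTorusLRO_iff`, `hasStaggeredTorusLRO_iff` display
  the textbook `liminf L^{-2d} Σ_{x y} G_L(x,y) > 0`.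

Sources: Friedli–Velenik, *Statistical Mechanics of Lattice Systems* (2017), §3.1 (periodic
boundary conditions), §3.7.2 (long-range order); Dyson–Lieb–Simon, *J. Stat. Phys.* 18 (1978), §1
(staggered/Néel long-range order on tori).

Design notes.
* Mathlib search: Mathlib has `ZMod`, `ZMod.val`, `SimpleGraph.fromRel`, `SimpleGraph.circulantGraph`
  (used by `StatMech.torusGraph`), `Filter.liminf`; it has no discrete-torus metric and no notion of
  long-range order (`rg "torusDist|torusNorm|LongRangeOrder"` in Mathlib finds nothing). Everything
  here is a thin wrapper.
* `Fintype (ZMod n)` needs `NeZero n`, so finiteness-dependent declarations (`torusBall`, the sums in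
  `hasTorusLRO_iff`) assume `[∀ i, NeZero (Ls i)]`, resp. are indexed by the side `L + 1`; the shift
  `L ↦ L + 1` does not change a `liminf` along `atTop` and is documented at `hasTorusLRO_iff`.
* Junk values: for `Ls i = 0` (`ZMod 0 = ℤ`) the `i`-th contribution to `torusNorm` is
  `min |xᵢ| (0 - |xᵢ|) = 0` (truncated subtraction); tori with a zero side are never used.
* The staggering sign lives on `ℤ^d` (`latticeStagger`), where it is canonical; on the torus
  `(ℤ/Lℤ)^d` the sign `(-1)^{Σ xᵢ}` is translation-covariant only for even `L`, which is why
  statements using `HasStaggeredTorusLRO` restrict to even sides (documented at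
  `hasStaggeredTorusLRO_iff`).
-/

noncomputable section

open Filter Finset

namespace Literature.MathematicalPhysics.QuantumLattice

open Literature.Probability.LatticeModels

variable {d : ℕ}

/-! ### Rectangular tori -/

/-- A site of the rectangular discrete torus `Π i, ℤ/(Ls i)ℤ` with side lengths `Ls : Fin d → ℕ`.
For constant `Ls = fun _ => L` this is `StatMech.TorusSite d L` by `rfl`.
(Friedli–Velenik 2017, §3.1, periodic boundary condition.) [cite: FriedliVelenik2017, §3.1  periodic boundary condition] -/
abbrev RectTorusSite (Ls : Fin d → ℕ) : Type := (i : Fin d) → ZMod (Ls i)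

/-- The cubic torus is the rectangular torus with constant sides, definitionally.
(Friedli–Velenik 2017, §3.1.) [cite: FriedliVelenik2017, §3.1] -/
theorem rectTorusSite_const (d L : ℕ) : RectTorusSite (fun _ : Fin d => L) = TorusSite d L := rfl

/-- The nearest-neighbour graph on the rectangular torus: `x ∼ y` iff `x ≠ y` and `y = x ± eᵢ` for
some coordinate direction `i`. (Friedli–Velenik 2017, §3.1.) [cite: FriedliVelenik2017, §3.1] -/
def rectTorusGraph (Ls : Fin d → ℕ) : SimpleGraph (RectTorusSite Ls) :=
  SimpleGraph.fromRel fun x y => ∃ i, y = x + Pi.single i 1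

/-- Adjacency on the rectangular torus, unfolded. (Friedli–Velenik 2017, §3.1.) [cite: FriedliVelenik2017, §3.1] -/
theorem rectTorusGraph_adj_iff {Ls : Fin d → ℕ} (x y : RectTorusSite Ls) :
    (rectTorusGraph Ls).Adj x y ↔
      x ≠ y ∧ ((∃ i, y = x + Pi.single i 1) ∨ ∃ i, x = y + Pi.single i 1) :=
  SimpleGraph.fromRel_adj _ _ _

/-- Adjacency on the rectangular torus is decidable. (Friedli–Velenik 2017, §3.1.) [cite: FriedliVelenik2017, §3.1] -/
instance instDecidableRelRectTorusAdj {Ls : Fin d → ℕ} : DecidableRel (rectTorusGraph Ls).Adj :=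
  fun x y => decidable_of_iff _ (rectTorusGraph_adj_iff x y).symm

/-- The canonical projection `ℤ^d → Π i, ℤ/(Ls i)ℤ`, coordinatewise reduction.
(`RectTorus` is not a type; the name is fixed by the outline, parallel to `StatMech.Torus.proj`.)
(Friedli–Velenik 2017, §3.1.) [cite: FriedliVelenik2017, §3.1] -/
def RectTorus.proj (Ls : Fin d → ℕ) (x : Site d) : RectTorusSite Ls := fun i => (x i : ZMod (Ls i))

/-- `RectTorus.proj` in coordinates. (Friedli–Velenik 2017, §3.1.) [cite: FriedliVelenik2017, §3.1] -/
@[simp] theorem RectTorus.proj_apply (Ls : Fin d → ℕ) (x : Site d) (i : Fin d) :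
    RectTorus.proj Ls x i = (x i : ZMod (Ls i)) := rfl

/-- On constant sides `RectTorus.proj` is `Torus.proj`. (Friedli–Velenik 2017, §3.1.) [cite: FriedliVelenik2017, §3.1] -/
theorem rectTorusProj_const (L : ℕ) (x : Site d) :
    RectTorus.proj (fun _ : Fin d => L) x = Torus.proj L x := rfl

/-- On constant sides the rectangular torus graph is the cubic torus graph `StatMech.torusGraph`.
(Friedli–Velenik 2017, §3.1.) [cite: FriedliVelenik2017, §3.1] -/
theorem rectTorusGraph_const (d L : ℕ) : rectTorusGraph (fun _ : Fin d => L) = torusGraph d L := by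
  ext x y
  exact (rectTorusGraph_adj_iff x y).trans (torusGraph_adj_iff x y).symm

/-! ### The torus metric -/

section Metric

variable {Ls : Fin d → ℕ}

/-- The periodic `ℓ^∞` norm on the rectangular torus:
`‖x‖ = maxᵢ min (xᵢ, Lsᵢ - xᵢ)` with `xᵢ ∈ {0, …, Lsᵢ - 1}` the canonical representative.
(For a zero side `Ls i = 0` the `i`-th term is the junk value `0`.)
(Friedli–Velenik 2017, §3.1.) [cite: FriedliVelenik2017, §3.1] -/
def torusNorm (x : RectTorusSite Ls) : ℕ :=
  Finset.univ.sup fun i => min (x i).val (Ls i - (x i).val)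

/-- The periodic `ℓ^∞` distance on the rectangular torus, `dist x y = ‖x - y‖`.
(Friedli–Velenik 2017, §3.1.) [cite: FriedliVelenik2017, §3.1] -/
def torusDist (x y : RectTorusSite Ls) : ℕ := torusNorm (x - y)

/-- `torusNorm 0 = 0`. (Friedli–Velenik 2017, §3.1.) [cite: FriedliVelenik2017, §3.1] -/
@[simp] theorem torusNorm_zero : torusNorm (0 : RectTorusSite Ls) = 0 := by
  simp [torusNorm]

/-- `torusDist x x = 0`. (Friedli–Velenik 2017, §3.1.) [cite: FriedliVelenik2017, §3.1] -/
@[simp] theorem torusDist_self (x : RectTorusSite Ls) : torusDist x x = 0 := by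
  simp [torusDist]

/-- The torus distance is symmetric. (Friedli–Velenik 2017, §3.1.) [cite: FriedliVelenik2017, §3.1] -/
def torusDist_comm : Prop :=
  ∀ (x y : RectTorusSite Ls),
    torusDist x y = torusDist y x

/-- The torus distance satisfies the triangle inequality (for nonzero sides).
(Friedli–Velenik 2017, §3.1.) [cite: FriedliVelenik2017, §3.1] -/
def torusDist_triangle : Prop :=
  ∀ [∀ i, NeZero (Ls i)] (x y z : RectTorusSite Ls),
    torusDist x z ≤ torusDist x y + torusDist y z

/-- The closed ball `{y | torusDist x y ≤ r}` of the torus metric, as a `Finset`.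
(Friedli–Velenik 2017, §3.1.) [cite: FriedliVelenik2017, §3.1] -/
def torusBall [∀ i, NeZero (Ls i)] (x : RectTorusSite Ls) (r : ℕ) : Finset (RectTorusSite Ls) :=
  {y | torusDist x y ≤ r}

/-- Membership in a torus ball. (Friedli–Velenik 2017, §3.1.) [cite: FriedliVelenik2017, §3.1] -/
@[simp] theorem mem_torusBall_iff [∀ i, NeZero (Ls i)] {x y : RectTorusSite Ls} {r : ℕ} :
    y ∈ torusBall x r ↔ torusDist x y ≤ r := by
  simp [torusBall]

/-- The centre belongs to every ball. (Friedli–Velenik 2017, §3.1.) [cite: FriedliVelenik2017, §3.1] -/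
theorem mem_torusBall_self [∀ i, NeZero (Ls i)] (x : RectTorusSite Ls) (r : ℕ) :
    x ∈ torusBall x r := by
  simp

end Metric

/-- The metric API specialises to cubic tori `TorusSite d L` with no coercion (sanity check of the
`rfl` in `rectTorusSite_const`; not a new declaration). -/
example {L : ℕ} [NeZero L] (x : TorusSite d L) (r : ℕ) : x ∈ torusBall x r := mem_torusBall_self x r

/-! ### Long-range order on tori of growing side -/

/-- Pull a family of torus two-point functions `G L : (ℤ/Lℤ)^d → (ℤ/Lℤ)^d → ℝ` back to `ℤ^d` along
`Torus.proj L` in both arguments. Restricted to the fundamental domain `halfOpenBox d L` this is a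
faithful copy of `G L` (`torusProj_bijOn_halfOpenBox`). (Outline §0 convention;
Friedli–Velenik 2017, §3.7.2.) [cite: FriedliVelenik2017, §3.7.2] -/
def torusPullback (G : (L : ℕ) → TorusSite d L → TorusSite d L → ℝ) : ℕ → Site d → Site d → ℝ :=
  fun L x y => G L (Torus.proj L x) (Torus.proj L y)

/-- `torusPullback` unfolded. (Friedli–Velenik 2017, §3.7.2.) [cite: FriedliVelenik2017, §3.7.2] -/
@[simp] theorem torusPullback_apply (G : (L : ℕ) → TorusSite d L → TorusSite d L → ℝ) (L : ℕ)
    (x y : Site d) : torusPullback G L x y = G L (Torus.proj L x) (Torus.proj L y) := rfl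

/-- Long-range order of a family of torus two-point functions `G L` on tori of side `L → ∞`:
`liminf_L L^{-2d} Σ_{x, y ∈ (ℤ/Lℤ)^d} G L x y > 0`, implemented as `StatMech.HasLongRangeOrder`
of the pull-back over the fundamental domains `halfOpenBox d L` (`L^d` sites).
(Friedli–Velenik 2017, §3.7.2, Definition 3.27; outline §0.) [cite: FriedliVelenik2017, §3.7.2  Definition 3.27] -/
def HasTorusLRO (G : (L : ℕ) → TorusSite d L → TorusSite d L → ℝ) : Prop :=
  HasLongRangeOrder (halfOpenBox d) (torusPullback G)

/-- The Néel staggering sign on `ℤ^d`, `ε x = (-1)^{Σᵢ |xᵢ|}` (`= (-1)^{Σᵢ xᵢ}`).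
(Dyson–Lieb–Simon 1978, §1.) [cite: DysonLiebSimon1978, §1] -/
def latticeStagger (x : Site d) : ℝ := (-1) ^ (∑ i, (x i).natAbs)

/-- `latticeStagger` unfolded. (Dyson–Lieb–Simon 1978, §1.) [cite: DysonLiebSimon1978, §1] -/
theorem latticeStagger_apply (x : Site d) : latticeStagger x = (-1) ^ (∑ i, (x i).natAbs) := rfl

/-- `latticeStagger 0 = 1`. (Dyson–Lieb–Simon 1978, §1.) [cite: DysonLiebSimon1978, §1] -/
@[simp] theorem latticeStagger_zero : latticeStagger (0 : Site d) = 1 := by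
  simp [latticeStagger]

/-- Nearest neighbours in `ℤ^d` carry opposite staggering signs. (Dyson–Lieb–Simon 1978, §1.) [cite: DysonLiebSimon1978, §1] -/
def latticeStagger_add_single : Prop :=
  ∀ (x : Site d) (i : Fin d),
    latticeStagger (x + Pi.single i 1) = -latticeStagger x

/-- Staggered (Néel) long-range order of a family of torus two-point functions:
`liminf_L L^{-2d} Σ_{x, y} (-1)^{x} (-1)^{y} G L x y > 0`, implemented as
`StatMech.HasStaggeredLongRangeOrder` of the pull-back with sign `latticeStagger` over
`halfOpenBox d L`. Meaningful for even sides `L` (see `hasStaggeredTorusLRO_iff`).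
(Dyson–Lieb–Simon 1978, §1; Friedli–Velenik 2017, §3.10.3; outline §0.) [cite: DysonLiebSimon1978, §1] -/
def HasStaggeredTorusLRO (G : (L : ℕ) → TorusSite d L → TorusSite d L → ℝ) : Prop :=
  HasStaggeredLongRangeOrder (halfOpenBox d) latticeStagger (torusPullback G)

/-- For `L ≠ 0`, `Torus.proj L` maps the fundamental domain `halfOpenBox d L = {0, …, L-1}^d`
bijectively onto the torus `(ℤ/Lℤ)^d`. (Friedli–Velenik 2017, §3.1.) [cite: FriedliVelenik2017, §3.1] -/
theorem torusProj_bijOn_halfOpenBox (L : ℕ) [NeZero L] :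
    Set.BijOn (Torus.proj (d := d) L) (halfOpenBox d L) Set.univ := by
  refine ⟨fun _ _ => Set.mem_univ _, ?_, ?_⟩
  · intro x hx y hy hxy
    simp only [Finset.mem_coe, mem_halfOpenBox] at hx hy
    funext i
    have h := congrFun hxy i
    simp only [Torus.proj_apply, ZMod.intCast_eq_intCast_iff'] at h
    rwa [Int.emod_eq_of_lt (hx i).1 (hx i).2, Int.emod_eq_of_lt (hy i).1 (hy i).2] at h
  · intro t _
    refine ⟨fun i => ((t i).val : ℤ), ?_, ?_⟩
    · simp only [Finset.mem_coe, mem_halfOpenBox]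
      exact fun i => ⟨by positivity, by exact_mod_cast ZMod.val_lt (t i)⟩
    · funext i
      simp

/-- Unfolding `HasTorusLRO` to the textbook form
`0 < liminf_{L → ∞} L^{-2d} Σ_{x, y ∈ (ℤ/Lℤ)^d} G L x y`.
The sequence is indexed by `L + 1` because `Fintype (ZMod L)` requires `L ≠ 0`; shifting the index
by one does not change a `liminf` along `atTop`. (Friedli–Velenik 2017, §3.7.2, eq. (3.41).) [cite: FriedliVelenik2017, §3.7.2  eq. (3.41] -/
def hasTorusLRO_iff : Prop :=
  ∀ (G : (L : ℕ) → TorusSite d L → TorusSite d L → ℝ),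
    HasTorusLRO G ↔
      0 < liminf (fun L : ℕ =>
        (∑ x : TorusSite d (L + 1), ∑ y : TorusSite d (L + 1), G (L + 1) x y) /
          ((L + 1 : ℕ) : ℝ) ^ (2 * d)) atTop

/-- Unfolding `HasStaggeredTorusLRO` to the textbook form
`0 < liminf_{L → ∞} L^{-2d} Σ_{x, y ∈ (ℤ/Lℤ)^d} (-1)^{Σ xᵢ} (-1)^{Σ yᵢ} G L x y`, the torus sign
being computed on canonical representatives `xᵢ ∈ {0, …, L-1}` (`ZMod.val`). Caveat: this sign is
a consistent sublattice sign on `(ℤ/Lℤ)^d` (neighbours have opposite signs) only when `L` is even;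
statements about Néel order therefore restrict to even sides. Indexing by `L + 1` as in
`hasTorusLRO_iff`. (Dyson–Lieb–Simon 1978, §1.) [cite: DysonLiebSimon1978, §1] -/
def hasStaggeredTorusLRO_iff : Prop :=
  ∀ (G : (L : ℕ) → TorusSite d L → TorusSite d L → ℝ),
    HasStaggeredTorusLRO G ↔
      0 < liminf (fun L : ℕ =>
        (∑ x : TorusSite d (L + 1), ∑ y : TorusSite d (L + 1),
            (-1 : ℝ) ^ (∑ i, (x i).val) * (-1) ^ (∑ i, (y i).val) * G (L + 1) x y) /
          ((L + 1 : ℕ) : ℝ) ^ (2 * d)) atTop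

end Literature.MathematicalPhysics.QuantumLattice
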